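import Literature.Analysis.FluidPDE.DoeringFoiasPowerProofs
import Literature.Analysis.FluidPDE.NSHopfExistenceProofs
import Literature.Analysis.FunctionSpaces.TorusFluidGlueProofs
import Literature.Analysis.FunctionSpaces.TorusTrigPoly
import HarnessLib

/-!
# Strategy census — typed part — crux `DopplerClock.InjectionControlsEnergy`
(stmt-AnomalousDissipation-18130; crux-strategist before the lead, 2026-08-17)

LITERATURE-ONLY COPY. The crux-dir farm reported `Theses.DopplerClock` incoherent at publish time
(`ledger crux write` rc 75 ×4), so this copy imports no `Summits` module and restates the crux
VERBATIM as the local `C2`; the evidence copy `CensusSketch.lean` (attached to the item,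
`lean check` rc 0, 0 sorries, 0 warnings) imports `Summits…Theses.DopplerClock` and proves every
statement below against the route decl BY NAME (there `crux_iff : InjectionControlsEnergy ↔ … :=
Iff.rfl`, so `C2` here ↔ `DopplerClock.InjectionControlsEnergy` by `Iff.rfl`). The three small
route-side lemmas it used (`dopplerForce_isSmooth`, `dopplerForce_hasZeroMean` from
Theorems/DopplerClockForceAdmissible, `impulseGrid_timeMean_injection_ge` from
Theorems/ImpulseGridGridSignsLawInjectionNonneg) are re-proved inline.

This scratch file (workfile class `cruxes-workfile`, NOT a Theorems file, nothing here closes or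
supports an item) records the Lean-checkable part of `STRATEGY-CENSUS.md`:

* §1 `crux_iff_ceiling` — the crux C2 (`meanEnergy u ≤ C·(1 + ⟨(f,u)⟩)`, ν-uniform `C`) is
  EQUIVALENT to a ν-uniform ABSOLUTE energy ceiling `UniformEnergyCeiling` for the pinned-momentum
  Leray–Hopf class of the swept two-mode force: the factor `(1 + W)` is decorative, because the mean
  injection is non-negative (`injection_nonneg`, energy inequality) and at most `‖f‖₂ √(meanEnergy)`
  (`injection_le`, Cauchy–Schwarz/Jensen, in tree as `Torus.IsGlobalLerayHopf.meanPower_le`).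
* §2 `boundedFamily_of_crux` — LOWER PIN: C2 implies the ∃-form `BoundedFamilyDoppler` ("there is a
  ν_j → 0 family of pinned Leray–Hopf flows of this force with j-uniform mean energy"), the Doppler
  twin of the censused open-problem-grade cruxes `GPMeanBoundedFamily` (stmt-15509),
  `Correlation.BoundedEnergyFamilyZM` (stmt-14641), `ImpulseGrid.UEDF` (stmt-14350 census): C2 is the
  UNIVERSAL (all data, all ν) strengthening of a statement whose existential form is already printed
  open (Constantin–Tarfulea–Vicol 2013 p. 2/3; Bedrossian–Coti Zelati–Punshon-Smith–Weber 2019 Rem. 1.6).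
* §3 `fixedViscosity_ceiling` — what IS provable: at each fixed ν the Cesàro means of the energy are
  bounded (`timeMean_norm_sq_le`), so C2's whole content is the ν-uniformity of one number.
* §4 strengthenings S⁺ as signatures (`LaminarCeiling` ⇒ C2 proved; `BanachMeanCeiling`,
  `PointwiseEventualCeiling` typed) and §5 decompositions as signatures (spectral split
  `CondensateFree`/`HighShellBounded` with glue PROVED modulo the split bookkeeping; ceiling split = §1).
* §6 `not_crux_iff_hoarding` — the honest shape of any disproof: ONE design (F,V,m,n) and pinned
  Leray–Hopf flows of ARBITRARILY LARGE mean energy (by §3 necessarily with ν → 0 or exploding data).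

Everything is sorry-free; signatures-only items are `def … : Prop`.
-/

noncomputable section

-- `Summit.<Summit>.<Problem>` is the tree's mandated summit-side namespace (CONVENTIONS §2).
set_option linter.dupNamespace false

open MeasureTheory Set Filter Topology UnitAddTorus
open scoped InnerProductSpace RealInnerProductSpace

namespace Summit.AnomalousDissipation.AnomalousDissipation.Cruxes.InjectionControlsEnergy.StrategyCensus

open Literature.Analysis.FluidPDE Literature.Analysis.FluidPDE.Torus
open Literature.Analysis.FunctionSpaces Literature.Analysis.FunctionSpaces.Torus

/-- The flat three-torus (local notation). -/
local notation "𝕋³" => UnitAddTorus (Fin 3)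
/-- Velocity values (local notation). -/
local notation "E³" => EuclideanSpace ℝ (Fin 3)

/-! ### §0 The objects of the crux, by name -/

/-- The swept Doppler pair `f(x) = F sin(2πm x₁) cos(2πn x₂) e₀`, verbatim the route's expression. -/
abbrev dopplerForce (F : ℝ) (m n : ℕ) : 𝕋³ → E³ := fun x =>
  (F * (mFourier (Pi.single (1 : Fin 3) (m : ℤ)) x).im *
    (mFourier (Pi.single (2 : Fin 3) (n : ℤ)) x).re) • EuclideanSpace.single (0 : Fin 3) (1 : ℝ)

/-- The pinned momentum `V e₂`. -/
abbrev drift (V : ℝ) : E³ := V • EuclideanSpace.single (2 : Fin 3) (1 : ℝ)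

/-- The `limsup`-mean injection `W = ⟨(f,u)⟩⁺`, verbatim the route's expression. -/
abbrev injection (F : ℝ) (m n : ℕ) (u : ℝ → 𝕋³ → E³) : ℝ :=
  longTimeAvgSup fun t => ∫ x, ⟪dopplerForce F m n x, u t x⟫

/-- Smoothness of the swept pair (inline copy of `Theorems.dopplerForce_isSmooth`). [folklore] -/
theorem dopplerForce_isSmooth' (F : ℝ) (m n : ℕ) : IsSmooth (dopplerForce F m n) := by
  have hk : IsSmooth (fun x : 𝕋³ => (mFourier (Pi.single (1 : Fin 3) (m : ℤ)) x).im) :=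
    (isSmooth_mFourier _).comp_clm Complex.imCLM
  have hl : IsSmooth (fun x : 𝕋³ => (mFourier (Pi.single (2 : Fin 3) (n : ℤ)) x).re) :=
    (isSmooth_mFourier _).comp_clm Complex.reCLM
  have hθ : IsSmooth (fun x : 𝕋³ => F * (mFourier (Pi.single (1 : Fin 3) (m : ℤ)) x).im *
      (mFourier (Pi.single (2 : Fin 3) (n : ℤ)) x).re) := by
    unfold IsSmooth at hk hl ⊢
    exact (contDiff_const.mul hk).mul hl
  exact hθ.smul' (isSmooth_const _)

/-- Product-to-sum for characters (inline copy). [folklore] -/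
theorem im_mFourier_mul_re_mFourier' (k l : Fin 3 → ℤ) (x : 𝕋³) :
    (mFourier k x).im * (mFourier l x).re =
      ((mFourier (k + l) x).im + (mFourier (k - l) x).im) / 2 := by
  rw [sub_eq_add_neg, mFourier_add, mFourier_add, mFourier_neg]
  simp only [Complex.mul_im, Complex.conj_re, Complex.conj_im]
  ring

/-- `∫ Im e_K = 0` over `T³` (inline copy). [folklore] -/
theorem integral_im_mFourier' (K : Fin 3 → ℤ) : ∫ x : 𝕋³, (mFourier K x).im = 0 := by
  have hint : Integrable (⇑(mFourier K) : 𝕋³ → ℂ) volume :=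
    (mFourier K).continuous.integrable_unitAddTorus
  have h := Complex.imCLM.integral_comp_comm hint
  simp only [Complex.imCLM_apply] at h
  rw [h, Torus.integral_mFourier]
  split_ifs <;> simp

/-- Zero mean of the swept pair (inline copy of `Theorems.dopplerForce_hasZeroMean`). [folklore] -/
theorem dopplerForce_hasZeroMean' (F : ℝ) (m n : ℕ) : HasZeroMean (dopplerForce F m n) := by
  set k : Fin 3 → ℤ := Pi.single (1 : Fin 3) (m : ℤ)
  set l : Fin 3 → ℤ := Pi.single (2 : Fin 3) (n : ℤ)
  have hi : ∀ K : Fin 3 → ℤ, Integrable (fun x : 𝕋³ => (mFourier K x).im) volume :=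
    fun K => (Complex.continuous_im.comp (mFourier K).continuous).integrable_unitAddTorus
  have h1 : ∀ x : 𝕋³, F * (mFourier k x).im * (mFourier l x).re =
      F / 2 * ((mFourier (k + l) x).im + (mFourier (k - l) x).im) := by
    intro x
    rw [mul_assoc, im_mFourier_mul_re_mFourier']
    ring
  have hθ : ∫ x : 𝕋³, F * (mFourier k x).im * (mFourier l x).re = 0 := by
    simp_rw [h1]
    rw [integral_const_mul, integral_add (hi (k + l)) (hi (k - l)), integral_im_mFourier',
      integral_im_mFourier', add_zero, mul_zero]
  show ∫ x : 𝕋³, (F * (mFourier k x).im * (mFourier l x).re) • EuclideanSpace.single (0 : Fin 3) (1 : ℝ) = 0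
  rw [integral_smul_const, hθ, zero_smul]

/-- **The crux, verbatim** (`Summit.AnomalousDissipation.AnomalousDissipation.Theses.DopplerClock.InjectionControlsEnergy`,
item stmt-AnomalousDissipation-18130; `C2 ↔ InjectionControlsEnergy := Iff.rfl` in the evidence copy). -/
def C2 : Prop :=
  ∀ (F V : ℝ) (m n : ℕ), 0 < F → 0 < V → 0 < m → 0 < n → ∃ C : ℝ, ∀ (ν : ℝ) (u₀ : UnitAddTorus (Fin 3) → EuclideanSpace ℝ (Fin 3)) (u : ℝ → UnitAddTorus (Fin 3) → EuclideanSpace ℝ (Fin 3)), 0 < ν → Literature.Analysis.FluidPDE.Torus.IsGlobalLerayHopf ν (fun _ => (fun (x : UnitAddTorus (Fin 3)) => (F * (UnitAddTorus.mFourier (Pi.single (1 : Fin 3) (m : ℤ)) x).im * (UnitAddTorus.mFourier (Pi.single (2 : Fin 3) (n : ℤ)) x).re) • EuclideanSpace.single (0 : Fin 3) (1 : ℝ))) u₀ u → (∫ x, u₀ x = V • EuclideanSpace.single (2 : Fin 3) (1 : ℝ)) → Literature.Analysis.FluidPDE.meanEnergy u ≤ C * (1 + Literature.Analysis.FluidPDE.longTimeAvgSup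 (fun t => ∫ x, inner ℝ ((F * (UnitAddTorus.mFourier (Pi.single (1 : Fin 3) (m : ℤ)) x).im * (UnitAddTorus.mFourier (Pi.single (2 : Fin 3) (n : ℤ)) x).re) • EuclideanSpace.single (0 : Fin 3) (1 : ℝ)) (u t x)))

/-- Sanity: the crux restated with the abbreviations is `C2` BY `Iff.rfl`. -/
theorem crux_iff :
    C2 ↔
      ∀ (F V : ℝ) (m n : ℕ), 0 < F → 0 < V → 0 < m → 0 < n → ∃ C : ℝ,
        ∀ (ν : ℝ) (u₀ : 𝕋³ → E³) (u : ℝ → 𝕋³ → E³), 0 < ν →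
          IsGlobalLerayHopf ν (fun _ => dopplerForce F m n) u₀ u → (∫ x, u₀ x = drift V) →
            meanEnergy u ≤ C * (1 + injection F m n u) :=
  Iff.rfl

/-- **Finite-time injection bound from below** (inline copy of `Theorems.impulseGrid_timeMean_injection_ge`):
`T⁻¹∫₀ᵀ(f,u) ≥ −½‖u₀‖²·T⁻¹`, the energy inequality from `0` (Leray 1934 (5.2)). [folklore] -/
theorem timeMean_injection_ge {ν : ℝ} {f u₀ : 𝕋³ → E³} {u : ℝ → 𝕋³ → E³} (hν : 0 ≤ ν)
    (hu : IsGlobalLerayHopf ν (fun _ => f) u₀ u) {T : ℝ} (hT : 0 < T) :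
    -(kineticEnergy u₀ * T⁻¹) ≤ timeMean (fun t => ∫ x, ⟪f x, u t x⟫) T := by
  have h := (hu T hT).energy_ineq_zero T ⟨hT.le, le_rfl⟩
  have hKE : 0 ≤ kineticEnergy (u T) := kineticEnergy_nonneg _
  have hD : 0 ≤ ν * (∫⁻ τ in Ioo 0 T, eGradNormSq (u τ)).toReal :=
    mul_nonneg hν ENNReal.toReal_nonneg
  have hI : -kineticEnergy u₀ ≤ ∫ τ in (0 : ℝ)..T, ∫ x, ⟪f x, u τ x⟫ := by
    have : kineticEnergy (u T) + ν * (∫⁻ τ in Ioo 0 T, eGradNormSq (u τ)).toReal ≤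
        kineticEnergy u₀ + ∫ τ in (0 : ℝ)..T, ∫ x, ⟪f x, u τ x⟫ := h
    linarith
  unfold timeMean
  have hTi : 0 ≤ T⁻¹ := inv_nonneg.2 hT.le
  calc -(kineticEnergy u₀ * T⁻¹) = T⁻¹ * (-kineticEnergy u₀) := by ring
    _ ≤ T⁻¹ * ∫ τ in (0 : ℝ)..T, ∫ x, ⟪f x, u τ x⟫ := mul_le_mul_of_nonneg_left hI hTi

/-! ### §1 The `(1 + W)` factor is decorative: C2 ⟺ a ν-uniform absolute energy ceiling -/

/-- **S⁺/D — ν-uniform absolute energy ceiling** for the pinned-momentum Leray–Hopf class of the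
swept pair: `∀ design ∃ E ∀ ν > 0 ∀ pinned LH u, ⟨‖u‖²⟩ ≤ E`. -/
def UniformEnergyCeiling : Prop :=
  ∀ (F V : ℝ) (m n : ℕ), 0 < F → 0 < V → 0 < m → 0 < n → ∃ E : ℝ,
    ∀ (ν : ℝ) (u₀ : 𝕋³ → E³) (u : ℝ → 𝕋³ → E³), 0 < ν →
      IsGlobalLerayHopf ν (fun _ => dopplerForce F m n) u₀ u → (∫ x, u₀ x = drift V) →
        meanEnergy u ≤ E

section Injection

variable {F : ℝ} {m n : ℕ} {ν : ℝ} {u₀ : 𝕋³ → E³} {u : ℝ → 𝕋³ → E³}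

/-- **Mean injection is non-negative** along every global Leray–Hopf solution of the swept pair
(no sup-energy hypothesis): the Cesàro means of `(f,u)` are `≥ −½‖u₀‖²/T`
(`impulseGrid_timeMean_injection_ge`, energy inequality from `0`) and bounded above
(`abs_timeMean_power_le` + `timeMean_norm_sq_le`), so their `limsup` is `≥ −ε` for every `ε > 0`. -/
theorem injection_nonneg (hν : 0 < ν) (hu : IsGlobalLerayHopf ν (fun _ => dopplerForce F m n) u₀ u) :
    0 ≤ injection F m n u := by
  have hf := dopplerForce_isSmooth' F m n
  have hf0 := dopplerForce_hasZeroMean' F m n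
  set P : ℝ → ℝ := fun t => ∫ x, ⟪dopplerForce F m n x, u t x⟫ with hPdef
  set E : ℝ → ℝ := fun t => ∫ x, ‖u t x‖ ^ 2 with hEdef
  set A : ℝ := Real.sqrt (∫ x, ‖dopplerForce F m n x‖ ^ 2) with hA
  set K : ℝ := kineticEnergy u₀ / (2 * Real.pi ^ 2 * ν) +
    (2 * ‖∫ x, u 1 x‖ ^ 2 + (∫ x, ‖dopplerForce F m n x‖ ^ 2) / (16 * Real.pi ^ 4 * ν ^ 2)) with hK
  have hA0 : 0 ≤ A := Real.sqrt_nonneg _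
  -- the Cesàro means of the injection are bounded above
  have hbdd : IsBoundedUnder (· ≤ ·) atTop (timeMean P) := by
    refine isBoundedUnder_of_eventually_le (a := A * Real.sqrt K) ?_
    filter_upwards [eventually_ge_atTop (1 : ℝ)] with T hT
    have hT0 : 0 < T := by linarith
    have h1 : |timeMean P T| ≤ A * Real.sqrt (timeMean E T) := hu.abs_timeMean_power_le hf hT0
    have h2 : timeMean E T ≤ K := hu.timeMean_norm_sq_le hν hf hf0 hT
    exact (le_abs_self _).trans (h1.trans (mul_le_mul_of_nonneg_left (Real.sqrt_le_sqrt h2) hA0))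
  -- and eventually `≥ -ε`
  show 0 ≤ limsup (timeMean P) atTop
  refine le_of_forall_pos_le_add fun ε hε => ?_
  have hE0 : 0 ≤ kineticEnergy u₀ := kineticEnergy_nonneg _
  have hev : ∀ᶠ T in atTop, -ε ≤ timeMean P T := by
    filter_upwards [eventually_gt_atTop 0, eventually_ge_atTop (kineticEnergy u₀ / ε)] with T hT hTε
    refine le_trans ?_ (timeMean_injection_ge hν.le hu hT)
    have h1 : kineticEnergy u₀ ≤ ε * T := by
      have := (div_le_iff₀ hε).1 hTε
      linarith [this]
    have h2 : kineticEnergy u₀ * T⁻¹ ≤ ε := by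
      rw [← div_eq_mul_inv, div_le_iff₀ hT]
      exact h1
    linarith
  have h := le_limsup_of_frequently_le hev.frequently hbdd
  linarith

/-- **Mean injection is at most `‖f‖₂ √⟨‖u‖²⟩`** (Cauchy–Schwarz in space, Jensen in time;
Cheskidov–Doering–Petrov 2007 eq. (17), in tree as `Torus.IsGlobalLerayHopf.meanPower_le`). -/
theorem injection_le (hν : 0 < ν) (hu : IsGlobalLerayHopf ν (fun _ => dopplerForce F m n) u₀ u) :
    injection F m n u ≤ Real.sqrt (∫ x, ‖dopplerForce F m n x‖ ^ 2) * Real.sqrt (meanEnergy u) := by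
  have h := hu.meanPower_le hν (dopplerForce_isSmooth' F m n) (dopplerForce_hasZeroMean' F m n)
  rw [rmsVelocity_eq_sqrt_meanEnergy] at h
  exact h

end Injection

/-- **C2 from the absolute ceiling** (uses only `injection_nonneg`): `C := max E 0`. -/
theorem crux_of_ceiling (h : UniformEnergyCeiling) : C2 := by
  intro F V m n hF hV hm hn
  obtain ⟨E, hE⟩ := h F V m n hF hV hm hn
  refine ⟨max E 0, fun ν u₀ u hν hu hmom => ?_⟩
  have h1 : meanEnergy u ≤ max E 0 := (hE ν u₀ u hν hu hmom).trans (le_max_left _ _)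
  have hW : 0 ≤ injection F m n u := injection_nonneg hν hu
  have h0 : 0 ≤ max E 0 := le_max_right _ _
  have h2 : max E 0 ≤ max E 0 * (1 + injection F m n u) := by nlinarith
  exact h1.trans h2

/-- **The absolute ceiling from C2** (uses `injection_le` and the quadratic inequality
`x ≤ C⁺(1 + A√x) ⇒ x ≤ 2C⁺ + (C⁺A)²`): `E := 2C⁺ + (C⁺‖f‖₂)²`, `C⁺ = max C 0`. -/
theorem ceiling_of_crux (h : C2) : UniformEnergyCeiling := by
  intro F V m n hF hV hm hn
  obtain ⟨C, hC⟩ := h F V m n hF hV hm hn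
  refine ⟨2 * max C 0 + (max C 0 * Real.sqrt (∫ x, ‖dopplerForce F m n x‖ ^ 2)) ^ 2,
    fun ν u₀ u hν hu hmom => ?_⟩
  set A : ℝ := Real.sqrt (∫ x, ‖dopplerForce F m n x‖ ^ 2) with hA
  have hE : meanEnergy u ≤ C * (1 + injection F m n u) := hC ν u₀ u hν hu hmom
  have hWle : injection F m n u ≤ A * Real.sqrt (meanEnergy u) := injection_le hν hu
  have hW0 : 0 ≤ injection F m n u := injection_nonneg hν hu
  have hE0 : 0 ≤ meanEnergy u := meanEnergy_nonneg u
  have hA0 : 0 ≤ A := Real.sqrt_nonneg _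
  have hCp0 : 0 ≤ max C 0 := le_max_right _ _
  have hCle : C ≤ max C 0 := le_max_left _ _
  have h1 : meanEnergy u ≤ max C 0 * (1 + injection F m n u) :=
    hE.trans (mul_le_mul_of_nonneg_right hCle (by linarith))
  have hs0 : 0 ≤ Real.sqrt (meanEnergy u) := Real.sqrt_nonneg _
  have hss : Real.sqrt (meanEnergy u) ^ 2 = meanEnergy u := Real.sq_sqrt hE0
  have h2 : meanEnergy u ≤ max C 0 + max C 0 * A * Real.sqrt (meanEnergy u) := by
    have h3 : max C 0 * injection F m n u ≤ max C 0 * (A * Real.sqrt (meanEnergy u)) :=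
      mul_le_mul_of_nonneg_left hWle hCp0
    nlinarith [h1, h3]
  nlinarith [h2, hss, hs0, mul_nonneg hCp0 hA0, sq_nonneg (max C 0 * A - Real.sqrt (meanEnergy u))]

/-- **§1, summary.** The crux is EXACTLY a ν-uniform absolute energy ceiling for the pinned class. -/
theorem crux_iff_ceiling : C2 ↔ UniformEnergyCeiling :=
  ⟨ceiling_of_crux, crux_of_ceiling⟩

/-! ### §2 Lower pin: the ∃-form (bounded family), a printed-open shape, follows from C2 -/

/-- **The ∃-form** (Doppler twin of `GPMeanBoundedFamily` stmt-15509 / `Correlation.BoundedEnergyFamilyZM`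
stmt-14641 / ImpulseGrid's `UEDF`): for every design there are `ν_j → 0⁺`, pinned data and global
Leray–Hopf flows of the swept pair with `j`-uniformly bounded mean energy. -/
def BoundedFamilyDoppler : Prop :=
  ∀ (F V : ℝ) (m n : ℕ), 0 < F → 0 < V → 0 < m → 0 < n → ∃ E : ℝ,
    ∃ (ν : ℕ → ℝ) (u₀ : ℕ → 𝕋³ → E³) (u : ℕ → ℝ → 𝕋³ → E³),
      (∀ j, 0 < ν j) ∧ Tendsto ν atTop (𝓝 0) ∧
      (∀ j, IsGlobalLerayHopf (ν j) (fun _ => dopplerForce F m n) (u₀ j) (u j)) ∧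
      (∀ j, ∫ x, u₀ j x = drift V) ∧ ∀ j, meanEnergy (u j) ≤ E

/-- Hopf's theorem (in tree, `hopf_existence_torus_holds`) from the constant datum `u₀ ≡ V e₂`:
at every `ν > 0` the pinned class is inhabited (the refuter's non-vacuity witness, all `ν`). -/
theorem exists_pinned_solution (F V : ℝ) (m n : ℕ) {ν : ℝ} (hν : 0 < ν) :
    ∃ u : ℝ → 𝕋³ → E³, IsGlobalLerayHopf ν (fun _ => dopplerForce F m n) (fun _ => drift V) u :=
  hopf_existence_torus_holds.steady hν (dopplerForce_isSmooth' F m n) (memLp_const (drift V))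
    (IsDivFree.isWeaklyDivFree_holds (isSmooth_const (drift V)) (isDivFree_fun_const (drift V)))

/-- The constant datum has momentum `V e₂` (Haar probability measure). -/
theorem integral_const_drift (V : ℝ) : ∫ _x : 𝕋³, drift V = drift V := by
  simp

/-- **Bounded family from the ceiling**: `ν_j = 1/(j+1)`, data `≡ V e₂`, Hopf solutions. -/
theorem boundedFamily_of_ceiling (h : UniformEnergyCeiling) : BoundedFamilyDoppler := by
  intro F V m n hF hV hm hn
  obtain ⟨E, hE⟩ := h F V m n hF hV hm hn
  have hνpos : ∀ j : ℕ, (0 : ℝ) < 1 / ((j : ℝ) + 1) := fun j => by positivity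
  choose u hu using fun j : ℕ => exists_pinned_solution F V m n (hνpos j)
  refine ⟨E, fun j => 1 / ((j : ℝ) + 1), fun _ _ => drift V, u, hνpos,
    tendsto_one_div_add_atTop_nhds_zero_nat, hu, fun _ => integral_const_drift V, fun j => ?_⟩
  exact hE _ _ _ (hνpos j) (hu j) (integral_const_drift V)

/-- **LOWER PIN.** `InjectionControlsEnergy → BoundedFamilyDoppler`. -/
theorem boundedFamily_of_crux (h : C2) : BoundedFamilyDoppler :=
  boundedFamily_of_ceiling (ceiling_of_crux h)

/-! ### §3 What is provable: the fixed-ν ceiling (the content of C2 is ν-uniformity alone) -/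

/-- **Fixed-ν Cesàro ceiling** (in tree, `Torus.IsGlobalLerayHopf.timeMean_norm_sq_le`, passed to
the `limsup`): `⟨‖u‖²⟩ ≤ ½‖u₀‖²/(2π²ν) + 2‖∫u(1)‖² + ‖f‖₂²/(16π⁴ν²)` — of order `ν⁻²`. (The sharper
data-independent form `⟨‖u‖²⟩ ≤ V² + ⟨(f,u)⟩/(4π²ν)` assembles from
`intervalIntegral_norm_sq_le_dissipation` + `integral_inner_const_eq` +
`DoeringFoias2002_dissipation_le_power_holds`; either way the constant blows up as `ν → 0`.) -/
theorem fixedViscosity_ceiling {F : ℝ} {m n : ℕ} {ν : ℝ} {u₀ : 𝕋³ → E³} {u : ℝ → 𝕋³ → E³}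
    (hν : 0 < ν) (hu : IsGlobalLerayHopf ν (fun _ => dopplerForce F m n) u₀ u) :
    meanEnergy u ≤ kineticEnergy u₀ / (2 * Real.pi ^ 2 * ν) +
      (2 * ‖∫ x, u 1 x‖ ^ 2 + (∫ x, ‖dopplerForce F m n x‖ ^ 2) / (16 * Real.pi ^ 4 * ν ^ 2)) := by
  rw [meanEnergy_eq_longTimeAvgSup]
  unfold longTimeAvgSup
  have hev : ∀ᶠ T in atTop, timeMean (fun t => ∫ x, ‖u t x‖ ^ 2) T ≤
      kineticEnergy u₀ / (2 * Real.pi ^ 2 * ν) +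
        (2 * ‖∫ x, u 1 x‖ ^ 2 + (∫ x, ‖dopplerForce F m n x‖ ^ 2) / (16 * Real.pi ^ 4 * ν ^ 2)) :=
    (eventually_ge_atTop (1 : ℝ)).mono fun T hT =>
      hu.timeMean_norm_sq_le hν (dopplerForce_isSmooth' F m n) (dopplerForce_hasZeroMean' F m n) hT
  have hco : IsCoboundedUnder (· ≤ ·) atTop (timeMean fun t => ∫ x, ‖u t x‖ ^ 2) :=
    isCoboundedUnder_le_of_eventually_le atTop
      ((eventually_ge_atTop (0 : ℝ)).mono fun T hT =>
        timeMean_nonneg (fun t => integral_nonneg fun _ => sq_nonneg _) hT)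
  exact limsup_le_of_le hco hev

/-! ### §4 Strengthenings S⁺ (signatures; the one that implies C2 cheaply is proved to) -/

/-- **S⁺_lam — relaminarisation in mean energy** (the route's kill criterion k3 in energy form):
every pinned Leray–Hopf flow has mean energy at most the ν-uniform laminar bound
`V² + F²/(4V²(2πn)²)` (`LaminarStreaks`: `∫‖u_L‖² = V² + F²/(4D) ≤ V² + F²/(4V²(2πn)²)`).
Stronger than C2; presumably FALSE for small ν (streak instability raises the energy above the
laminar level — or turbulence lowers it; the DNS of j023077 decides which at accessible ν), and where
provable (energy-method stability, `4π²ν > ‖∇u_L‖_∞ ~ Fκ/(2πnV)`) C2 is trivial anyway. -/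
def LaminarCeiling : Prop :=
  ∀ (F V : ℝ) (m n : ℕ), 0 < F → 0 < V → 0 < m → 0 < n →
    ∀ (ν : ℝ) (u₀ : 𝕋³ → E³) (u : ℝ → 𝕋³ → E³), 0 < ν →
      IsGlobalLerayHopf ν (fun _ => dopplerForce F m n) u₀ u → (∫ x, u₀ x = drift V) →
        meanEnergy u ≤ V ^ 2 + F ^ 2 / (4 * V ^ 2 * (2 * Real.pi * n) ^ 2)

theorem ceiling_of_laminarCeiling (h : LaminarCeiling) : UniformEnergyCeiling :=
  fun F V m n hF hV hm hn => ⟨_, fun ν u₀ u hν hu hmom => h F V m n hF hV hm hn ν u₀ u hν hu hmom⟩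

theorem crux_of_laminarCeiling (h : LaminarCeiling) : C2 :=
  crux_of_ceiling (ceiling_of_laminarCeiling h)

/-- **S⁺_pt — pointwise eventual ceiling**: `limsup_{t→∞} ‖u(t)‖² ≤ E` uniformly (an absorbing
ball of ν-independent radius). Strictly stronger in form than the Cesàro ceiling; no easier (the
only absorbing balls known have radius `~ ‖f‖/(νλ₁)`, FMRT 2001 (13.11)). Signature only. -/
def PointwiseEventualCeiling : Prop :=
  ∀ (F V : ℝ) (m n : ℕ), 0 < F → 0 < V → 0 < m → 0 < n → ∃ E : ℝ,
    ∀ (ν : ℝ) (u₀ : 𝕋³ → E³) (u : ℝ → 𝕋³ → E³), 0 < ν →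
      IsGlobalLerayHopf ν (fun _ => dopplerForce F m n) u₀ u → (∫ x, u₀ x = drift V) →
        ∀ᶠ t in atTop, ∫ x, ‖u t x‖ ^ 2 ≤ E

/-- **S⁺_Λ — Banach-mean (linear) form**: for every generalized limit `Λ` and every pinned flow with
a sup-in-time energy bound, `Λ⟨‖u‖²⟩ ≤ C(1 + Λ⟨(f,u)⟩)`. Linear means make the exact two-mode
identities (`DopplerWorkIdentity`) additive, but they supply no UPPER bound on `Λ⟨‖u‖²⟩`: the
identities contain the unknown Reynolds stresses `Λ⟨T_c⟩, Λ⟨T_s⟩`. Signature only (costume risk: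
it is C2 in linear dress). -/
def BanachMeanCeiling : Prop :=
  ∀ (F V : ℝ) (m n : ℕ), 0 < F → 0 < V → 0 < m → 0 < n → ∃ C : ℝ,
    ∀ (Λ : GeneralizedLimit) (ν : ℝ) (u₀ : 𝕋³ → E³) (u : ℝ → 𝕋³ → E³), 0 < ν →
      IsGlobalLerayHopf ν (fun _ => dopplerForce F m n) u₀ u → (∫ x, u₀ x = drift V) →
      (∃ K : ℝ, ∀ t : ℝ, 0 ≤ t → kineticEnergy (u t) ≤ K) →
        Λ.longTimeAvg (fun t => ∫ x, ‖u t x‖ ^ 2) ≤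
          C * (1 + Λ.longTimeAvg (fun t => ∫ x, ⟪dopplerForce F m n x, u t x⟫))

/-! ### §5 Decompositions (signatures; the spectral glue is proved modulo its bookkeeping) -/

/-- **D_spec, piece 1 — no infrared pile-up** (the birth skeleton's `stub_condensateFree`): the mean
energy carried by the modes `|k| ≤ K` (`fourierTruncate K`, any fixed `K ≥ κ_f`) is ν-uniformly
controlled by the mean energy above `K` plus injection. This is where a 3-D condensate would live
(unswept shell-1 modes `k = (±1,0,0), (0,±1,0)`); OPEN — no handle on backscatter. -/
def CondensateFree (K : ℕ) : Prop :=
  ∀ (F V : ℝ) (m n : ℕ), 0 < F → 0 < V → 0 < m → 0 < n → ∃ C : ℝ,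
    ∀ (ν : ℝ) (u₀ : 𝕋³ → E³) (u : ℝ → 𝕋³ → E³), 0 < ν →
      IsGlobalLerayHopf ν (fun _ => dopplerForce F m n) u₀ u → (∫ x, u₀ x = drift V) →
        meanEnergy (fun t => fourierTruncate K (u t)) ≤
          C * (1 + meanEnergy (fun t x => u t x - fourierTruncate K (u t) x) + injection F m n u)

/-- **D_spec, piece 2 — ν-uniform tail bound** (the birth skeleton's `stub_highShellBounded`, rated
"L" there; it is NOT: at fixed ν Poincaré gives `⟨‖Q_K u‖²⟩ ≤ ε/(νK²)` only, and a ν-uniform bound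
on the energy above the forcing shell for ALL Leray–Hopf flows is a K41-spectrum statement of the
summit's kind — OPEN). -/
def HighShellBounded (K : ℕ) : Prop :=
  ∀ (F V : ℝ) (m n : ℕ), 0 < F → 0 < V → 0 < m → 0 < n → ∃ C : ℝ,
    ∀ (ν : ℝ) (u₀ : 𝕋³ → E³) (u : ℝ → 𝕋³ → E³), 0 < ν →
      IsGlobalLerayHopf ν (fun _ => dopplerForce F m n) u₀ u → (∫ x, u₀ x = drift V) →
        meanEnergy (fun t x => u t x - fourierTruncate K (u t) x) ≤ C * (1 + injection F m n u)

/-- **D_spec bookkeeping** (provable, M: Parseval orthogonality of `P_K`/`Q_K` slice-wise +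
sub-additivity of `limsup`): `⟨‖u‖²⟩ ≤ ⟨‖P_K u‖²⟩ + ⟨‖Q_K u‖²⟩` along Leray–Hopf flows. Signature. -/
def SpectralSplit (K : ℕ) : Prop :=
  ∀ (F : ℝ) (m n : ℕ) (ν : ℝ) (u₀ : 𝕋³ → E³) (u : ℝ → 𝕋³ → E³), 0 < ν →
    IsGlobalLerayHopf ν (fun _ => dopplerForce F m n) u₀ u →
      meanEnergy u ≤ meanEnergy (fun t => fourierTruncate K (u t)) +
        meanEnergy (fun t x => u t x - fourierTruncate K (u t) x)

/-- **D_spec glue, PROVED**: `SpectralSplit K → CondensateFree K → HighShellBounded K → C2`.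
Both content pieces are open; the split isolates nothing tractable (census §Decomposition D1). -/
theorem crux_of_spectralSplit (K : ℕ) (hS : SpectralSplit K) (hC : CondensateFree K)
    (hH : HighShellBounded K) : C2 := by
  intro F V m n hF hV hm hn
  obtain ⟨C₁, h₁⟩ := hC F V m n hF hV hm hn
  obtain ⟨C₂, h₂⟩ := hH F V m n hF hV hm hn
  refine ⟨max C₁ 0 * (1 + max C₂ 0) + max C₂ 0, fun ν u₀ u hν hu hmom => ?_⟩
  have hs := hS F m n ν u₀ u hν hu
  have hl := h₁ ν u₀ u hν hu hmom
  have hh := h₂ ν u₀ u hν hu hmom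
  have hW : 0 ≤ injection F m n u := injection_nonneg hν hu
  set W := injection F m n u
  set EL := meanEnergy (fun t => fourierTruncate K (u t))
  set EH := meanEnergy (fun t x => u t x - fourierTruncate K (u t) x)
  have hEH0 : 0 ≤ EH := meanEnergy_nonneg _
  have hC1 : C₁ ≤ max C₁ 0 := le_max_left _ _
  have hC10 : 0 ≤ max C₁ 0 := le_max_right _ _
  have hC2 : C₂ ≤ max C₂ 0 := le_max_left _ _
  have hC20 : 0 ≤ max C₂ 0 := le_max_right _ _
  have hh' : EH ≤ max C₂ 0 * (1 + W) := hh.trans (mul_le_mul_of_nonneg_right hC2 (by linarith))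
  have hl' : EL ≤ max C₁ 0 * (1 + EH + W) := hl.trans (mul_le_mul_of_nonneg_right hC1 (by linarith))
  have hl'' : EL ≤ max C₁ 0 * (1 + max C₂ 0) * (1 + W) := by
    have : 1 + EH + W ≤ (1 + max C₂ 0) * (1 + W) := by nlinarith
    calc EL ≤ max C₁ 0 * (1 + EH + W) := hl'
      _ ≤ max C₁ 0 * ((1 + max C₂ 0) * (1 + W)) := mul_le_mul_of_nonneg_left this hC10
      _ = max C₁ 0 * (1 + max C₂ 0) * (1 + W) := by ring
  calc meanEnergy u ≤ EL + EH := hs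
    _ ≤ max C₁ 0 * (1 + max C₂ 0) * (1 + W) + max C₂ 0 * (1 + W) := add_le_add hl'' hh'
    _ = (max C₁ 0 * (1 + max C₂ 0) + max C₂ 0) * (1 + W) := by ring

/-! ### §6 Negation: the honest shape of a disproof -/

/-- **¬C2 ⟺ one design with pinned hoarders of arbitrarily large mean energy** (via §1). A refuter
needs ONE `(F,V,m,n)` and, for every level `E`, a viscosity and a pinned global Leray–Hopf flow whose
Cesàro-`limsup` energy exceeds `E` — by §3 only possible with `ν → 0` (or data so large that the
fixed-ν ceiling exceeds `E`, which the sharper data-independent fixed-ν bound excludes). -/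
theorem not_crux_iff_hoarding :
    ¬ C2 ↔
      ∃ (F V : ℝ) (m n : ℕ), 0 < F ∧ 0 < V ∧ 0 < m ∧ 0 < n ∧ ∀ E : ℝ,
        ∃ (ν : ℝ) (u₀ : 𝕋³ → E³) (u : ℝ → 𝕋³ → E³), 0 < ν ∧
          IsGlobalLerayHopf ν (fun _ => dopplerForce F m n) u₀ u ∧ (∫ x, u₀ x = drift V) ∧
            E < meanEnergy u := by
  rw [crux_iff_ceiling]
  unfold UniformEnergyCeiling
  push Not
  rfl

end Summit.AnomalousDissipation.AnomalousDissipation.Cruxes.InjectionControlsEnergy.StrategyCensus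

end
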